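import Summits.QuantumFields.YangMills.Theorems.ComplexCouplingChannelFreeEnergyWindowChannelStructure
import Summits.QuantumFields.YangMills.Theorems.ComplexCouplingChannelFreeEnergyWindowChannelStubCumulantRadiusOfCrux
import HarnessLib

/-!
# LOCAL ⇔ CUMULANT RADIUS: volume-uniform zero-free discs at real couplings are volume-uniform analyticity radii

Crux `FreeEnergyWindowChannel` (stmt-QuantumFields-18842, route `ComplexCouplingChannel` of `QuantumFields/YangMills`), line `Sketch`,
layer 6 (lead c3).  The two forms of the LOCAL (weak-coupling) piece of the crux's regime split are EQUIVALENT, independently of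
the crux and of REACH:

* LOCAL: beyond some `β₁`, around every real `t ≥ β₁` there is a disc `ball t δ` on which the complex-coupling symmetric-torus
  Wilson partition functions `Z_P z = wilsonFinTorusPartitionC r.ρ z P P P P`, `P ≥ P₀`, have no zeros (`δ` uniform in `P`);
* CUMULANT RADIUS: beyond some `β₁`, at every real `t ≥ β₁` the derivatives at `t` of the finite-volume free energies
  `s ↦ log Z_ℝ(s; P⁴)` (up to sign the cumulants of the total Wilson action under the torus Gibbs measure at coupling `t`) obey
  `|∂ⁿ log Z_P(t)| ≤ K_P · n! · Cⁿ` (`n ≥ 1`, `P ≥ P₀`) with `C` uniform in `P` — a purely REAL-VARIABLE statement.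

`cumulantRadius_of_local` (LOCAL ⇒ K): on the zero-free disc `log ‖Z_P‖ = Re g_P` with `g_P` holomorphic
(`exists_differentiableOn_re_eq_log_norm`), `Re g_P ≤ max (sup ‖Z_P‖) 1` (compact closed disc), so Borel–Carathéodory and Cauchy
(`norm_iteratedDeriv_le_of_re_le`, landed with `stub_cumulantRadius_of_crux`) give `‖g_P⁽ⁿ⁾(t)‖ ≤ n! K_P /(δ/4)ⁿ`, and at real `s`
the free energy is `Re g_P(s)` (`iteratedDeriv_re_comp_ofReal`); `C = 4/δ`.  The converse `local_of_cumulantRadius` (K ⇒ LOCAL, radius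
`1/C`, Taylor series + identity theorem through `stub_zeroFreeOfDerivBounds`) is in `…FreeEnergyWindowChannelStructure.lean`;
`local_iff_cumulantRadius` records the equivalence.  With `freeEnergyWindowChannel_iff_reach_and_local` this is the second route
to `freeEnergyWindowChannel_iff_reach_and_cumulantRadius`.

References: E. Borel (1897) / C. Carathéodory (Borel–Carathéodory inequality, Mathlib `Complex.borelCaratheodory`); Cauchy's
estimates (Mathlib `Complex.norm_iteratedDeriv_le_of_forall_mem_sphere_norm_le`).
-/

set_option autoImplicit false

noncomputable section

open scoped Topology
open MeasureTheory Filter Set Metric Complex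
open Literature.MathematicalPhysics.QuantumFieldTheory

namespace Summit.QuantumFields.YangMills.Theorems.FreeEnergyWindowChannel

/-- **LOCAL ⇒ CUMULANT RADIUS.**  A `P`-uniform zero-free disc `ball t δ` of the symmetric-torus partition functions around
every large real `t` gives the volume-uniform geometric bound `|∂ⁿ log Z_ℝ(·; P⁴)(t)| ≤ K_P n! (4/δ)ⁿ` (`n ≥ 1`, `P ≥ P₀`)
(holomorphic `g_P` with `Re g_P = log ‖Z_P‖` on the disc, `Re g_P ≤ max (sup ‖Z_P‖) 1`, Borel–Carathéodory + Cauchy at `t`,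
`K_P = 2 max B_P 1 + 3 ‖g_P t‖`). [folklore] -/
theorem cumulantRadius_of_local
    (hL : ∀ (G : Type) [Group G] [TopologicalSpace G] [IsTopologicalGroup G] [CompactSpace G] [MeasurableSpace G] [BorelSpace G], Literature.MathematicalPhysics.QuantumFieldTheory.IsCompactSimpleLieGroup G → ∀ r : Literature.MathematicalPhysics.QuantumFieldTheory.LatticeRep G,
      ∃ β₁ : ℝ, ∀ t : ℝ, β₁ ≤ t → ∃ δ : ℝ, 0 < δ ∧ ∃ P₀ : ℕ, ∀ P : ℕ, P₀ ≤ P → ∀ z ∈ Metric.ball ((t : ℝ) : ℂ) δ,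
        wilsonFinTorusPartitionC r.ρ z P P P P ≠ 0) :
    ∀ (G : Type) [Group G] [TopologicalSpace G] [IsTopologicalGroup G] [CompactSpace G] [MeasurableSpace G] [BorelSpace G], Literature.MathematicalPhysics.QuantumFieldTheory.IsCompactSimpleLieGroup G → ∀ r : Literature.MathematicalPhysics.QuantumFieldTheory.LatticeRep G,
      ∃ β₁ : ℝ, ∀ t : ℝ, β₁ ≤ t → ∃ C : ℝ, 0 < C ∧ ∃ P₀ : ℕ, ∀ P : ℕ, P₀ ≤ P → ∃ K : ℝ, ∀ n : ℕ, 1 ≤ n →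
        |iteratedDeriv n (fun s : ℝ => Real.log (wilsonFinTorusPartition r.ρ s P P P P)) t| ≤ K * n.factorial * C ^ n := by
  intro G _ _ _ _ _ _ hG r
  haveI : SecondCountableTopology G :=
    (r.continuous.isClosedEmbedding r.injective).isEmbedding.secondCountableTopology
  obtain ⟨β₁, hβ₁⟩ := hL G hG r
  refine ⟨β₁, fun t ht => ?_⟩
  obtain ⟨R, hR, P₀, hP₀⟩ := hβ₁ t ht
  refine ⟨4 / R, by positivity, P₀, fun P hP => ?_⟩
  -- the entire partition function of the torus `P⁴`, zero-free on the disc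
  set Z : ℂ → ℂ := fun z => wilsonFinTorusPartitionC r.ρ z P P P P with hZ
  have hZd : Differentiable ℂ Z := differentiable_wilsonFinTorusPartitionC r.ρ r.continuous P P P P
  have hZ0 : ∀ z ∈ ball (t : ℂ) R, Z z ≠ 0 := fun z hz => hP₀ P hP z hz
  -- `log ‖Z‖ = Re g` on the disc, `g` holomorphic
  obtain ⟨g, hgd, hg⟩ := exists_differentiableOn_re_eq_log_norm (c := (t : ℂ)) hR hZd.differentiableOn hZ0
  -- `Re g = log ‖Z‖ ≤ ‖Z‖ ≤ B` on the disc
  obtain ⟨B, hB⟩ :=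
    (isCompact_closedBall (t : ℂ) R).exists_bound_of_continuousOn hZd.continuous.continuousOn
  set M' : ℝ := max B 1 with hM'
  have hM'0 : 0 < M' := lt_of_lt_of_le one_pos (le_max_right _ _)
  have hre : ∀ z ∈ ball (t : ℂ) R, (g z).re ≤ M' := fun z hz => by
    rw [hg z hz]
    exact ((Real.log_le_self (norm_nonneg _)).trans (hB z (ball_subset_closedBall hz))).trans (le_max_left _ _)
  -- Borel–Carathéodory + Cauchy at the centre `t`
  set K : ℝ := 2 * M' + 3 * ‖g t‖ with hK
  refine ⟨K, fun n _ => ?_⟩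
  have hder : ‖iteratedDeriv n g t‖ ≤ n.factorial * K / (R / 4) ^ n :=
    norm_iteratedDeriv_le_of_re_le hR hM'0 hgd hre n
  -- the real side: at real couplings near `t` the free energy is `Re g`
  have hU : IsOpen (ball (t : ℂ) R) := isOpen_ball
  have htU : ((t : ℝ) : ℂ) ∈ ball (t : ℂ) R := mem_ball_self hR
  have hnorm : ∀ s : ℝ, ‖Z (s : ℂ)‖ = wilsonFinTorusPartition r.ρ s P P P P := fun s => by
    simp only [hZ, wilsonFinTorusPartitionC_ofReal, Complex.norm_real, Real.norm_eq_abs]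
    exact abs_of_pos (wilsonFinTorusPartition_pos r.continuous s P P P P)
  have hEq : (fun s : ℝ => Real.log (wilsonFinTorusPartition r.ρ s P P P P)) =ᶠ[𝓝 t]
      fun s : ℝ => (g s).re := by
    filter_upwards [continuous_ofReal.continuousAt.preimage_mem_nhds (hU.mem_nhds htU)] with s hs
    rw [hg _ hs, hnorm s]
  rw [hEq.iteratedDeriv_eq n, iteratedDeriv_re_comp_ofReal hU n hgd htU]
  calc |(iteratedDeriv n g t).re| ≤ ‖iteratedDeriv n g t‖ := Complex.abs_re_le_norm _
    _ ≤ n.factorial * K / (R / 4) ^ n := hder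
    _ = K * n.factorial * (4 / R) ^ n := by
        rw [show (4 / R) ^ n = ((R / 4) ^ n)⁻¹ by rw [← inv_pow, inv_div]]
        ring

/-- **LOCAL ⇔ CUMULANT RADIUS** (for the crux's family of symmetric-torus Wilson partition functions, at every admissible
`(G, r)`): `P`-uniform zero-free discs around every large real coupling ⇔ `P`-uniform geometric growth of the derivatives of
the finite-volume free energies at every large real coupling (`→`: `cumulantRadius_of_local`; `←`: `local_of_cumulantRadius`).
[folklore] -/
theorem local_iff_cumulantRadius :
    (∀ (G : Type) [Group G] [TopologicalSpace G] [IsTopologicalGroup G] [CompactSpace G] [MeasurableSpace G] [BorelSpace G], Literature.MathematicalPhysics.QuantumFieldTheory.IsCompactSimpleLieGroup G → ∀ r : Literature.MathematicalPhysics.QuantumFieldTheory.LatticeRep G,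
      ∃ β₁ : ℝ, ∀ t : ℝ, β₁ ≤ t → ∃ δ : ℝ, 0 < δ ∧ ∃ P₀ : ℕ, ∀ P : ℕ, P₀ ≤ P → ∀ z ∈ Metric.ball ((t : ℝ) : ℂ) δ,
        wilsonFinTorusPartitionC r.ρ z P P P P ≠ 0) ↔
    (∀ (G : Type) [Group G] [TopologicalSpace G] [IsTopologicalGroup G] [CompactSpace G] [MeasurableSpace G] [BorelSpace G], Literature.MathematicalPhysics.QuantumFieldTheory.IsCompactSimpleLieGroup G → ∀ r : Literature.MathematicalPhysics.QuantumFieldTheory.LatticeRep G,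
      ∃ β₁ : ℝ, ∀ t : ℝ, β₁ ≤ t → ∃ C : ℝ, 0 < C ∧ ∃ P₀ : ℕ, ∀ P : ℕ, P₀ ≤ P → ∃ K : ℝ, ∀ n : ℕ, 1 ≤ n →
        |iteratedDeriv n (fun s : ℝ => Real.log (wilsonFinTorusPartition r.ρ s P P P P)) t| ≤ K * n.factorial * C ^ n) :=
  ⟨cumulantRadius_of_local, local_of_cumulantRadius⟩


/-- **Registered stub `stub_localIffCumulantRadius` of line `Sketch`** (layer 6, lead c3; = `local_iff_cumulantRadius`, the name
under which the lead's skeleton consumes this file). [folklore] -/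
theorem stub_localIffCumulantRadius :
    ((∀ (G : Type) [Group G] [TopologicalSpace G] [IsTopologicalGroup G] [CompactSpace G] [MeasurableSpace G] [BorelSpace G], Literature.MathematicalPhysics.QuantumFieldTheory.IsCompactSimpleLieGroup G → ∀ r : Literature.MathematicalPhysics.QuantumFieldTheory.LatticeRep G, ∃ β₁ : ℝ, ∀ t : ℝ, β₁ ≤ t → ∃ δ : ℝ, 0 < δ ∧ ∃ P₀ : ℕ, ∀ P : ℕ, P₀ ≤ P → ∀ z ∈ Metric.ball ((t : ℝ) : ℂ) δ, Literature.MathematicalPhysics.QuantumFieldTheory.wilsonFinTorusPartitionC r.ρ z P P P P ≠ 0) ↔ (∀ (G : Type) [Group G] [TopologicalSpace G] [IsTopologicalGroup G] [CompactSpace G] [MeasurableSpace G] [BorelSpace G], Literature.MathematicalPhysics.QuantumFieldTheory.IsCompactSimpleLieGroup G → ∀ r : Literature.MathematicalPhysics.QuantumFieldTheory.LatticeRep G, ∃ β₁ : ℝ, ∀ t : ℝ, β₁ ≤ t → ∃ C : ℝ, 0 < C ∧ ∃ P₀ : ℕ, ∀ P : ℕ, P₀ ≤ P → ∃ K : ℝ,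 ∀ n : ℕ, 1 ≤ n → |iteratedDeriv n (fun s : ℝ => Real.log (Literature.MathematicalPhysics.QuantumFieldTheory.wilsonFinTorusPartition r.ρ s P P P P)) t| ≤ K * n.factorial * C ^ n)) :=
  local_iff_cumulantRadius

end Summit.QuantumFields.YangMills.Theorems.FreeEnergyWindowChannel

end
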